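import Summits.QuantumFields.YangMills.Theorems.CoarseStiffnessTailCappedCoarseStiffnessLUnitPolyTail

/-!
# Crux `HistoryTailL` (stmt-QuantumFields-19936) — LINE 20 «unit-poly-tail» (ideator seat ym-r3-idea-2 g10, lens «nearmiss»)

The line IS route `CoarseStiffnessTail` rev 1 (route-QuantumFields-CoarseStiffnessTail, OPEN): its re-typed deciding crux
`UnitPolyTailL` (stmt-QuantumFields-24027 = S1_poly: the single-plaquette tail of the FULLY block-averaged field at the unit scale is
`O(γ^s)` for some `s > 3`, uniformly in the cut-off `K`) is cut into three stubs — the BOUNDED-CUT-OFF SLICES (`stub_boundedCutoff`, every `K ≤ K₀`, volume-uniform: the BC5 witness, proved at once by this seat), the ORGAN (`stub_topTailDegradedEv`, eventually in `K`: the same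
tail in the DEGRADED-GAUSSIAN format that a transcription of Bałaban's last renormalisation step delivers, exponent
`−c·p(√γ)² + κ·(1 + log(√γ)⁻¹)^q` with `q < 2p₀` (collar entropy, [Balaban1985UV3] (39) p.266 / (71) p.273) and a polynomial prefactor
`γ^(−A)` (Jacobians, determinants, plaquette counts in a collar)) and the ABSORPTION (`stub_absorbRate`: that format is below `C·γ^s` for
every `s` once `γ` is small, because `p(√γ)² = b₀²(1 + ½log γ⁻¹)^{2p₀}` beats both `(1 + ½log γ⁻¹)^q` and `A·log γ⁻¹`; cf. the landed
`CoarseStiffnessTailUnitPolyTailOfCount.exp_neg_pFun_sq_le_pow`).  The composition is the landed glue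
`CoarseStiffnessTailUnitPolyTail.historyTailL_of_unitPolyTail` (✓p687579, seat ym-line-cst-p1) and gives `UnitScaleTilt.HistoryTailL`
BY NAME.  Sorries ONLY inside `stub_*`.  No summit, no rung (`YM3TorusSU2`), no mass gap is proved; `HistoryTailL` and `UnitPolyTailL`
stay open behind the stubs.

Disproof used: none registered for 24027 (new item); for 19936 the standing obstruction is volume/cut-off UNIFORMITY — honoured: both
stubs quantify `∀ K` AFTER the constants.  Dead lines avoided: the Gaussian-RATE exponential moment (S1_top, `stub_unitLargeFieldCount`
of Lines/birth.lean on 25301) is NOT asked — only its power-law shadow.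
-/

namespace Summit.QuantumFields.YangMills.Cruxes.HistoryTailL.UnitPolyTail

open scoped BigOperators Topology Classical MeasureTheory ProbabilityTheory Matrix
open Filter Set Function TopologicalSpace MeasureTheory
open Literature.MathematicalPhysics.QuantumFieldTheory.Balaban1983to89
open Literature.MathematicalPhysics.QuantumFieldTheory.Balaban1983to89.T3ContinuumYM3Torus
open Summit.QuantumFields.YangMills.Theses.CoarseStiffnessTail (UnitPolyTailL)
open Summit.QuantumFields.YangMills.Theorems.CoarseStiffnessTailUnitPolyTail (historyTailL_of_unitPolyTail)

/-! ## §1 The registered stubs (the ONLY sorries) -/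

/-- STUB 0 — **EVERY BOUNDED CUT-OFF RANGE, VOLUME-UNIFORMLY** (M; the BC5 witness, PROVED by this seat as
`Theorems/CoarseStiffnessTailUnitPolyTailLBoundedCutoff.lean`; the `K = 0` slice alone is ✓ `CoarseStiffnessTailUnitPolyTailLRungK0`, seat
ym-line-cst-p1 g23): for every `K₀`, `L` and EVERY profile `b₀ > 0`, `p₀ > 2` there are `s > 3`, `C`, `γ₁` with
`Gibbs_K{θ_γ(0) ≤ |Ū^K(∂a) − 1|} ≤ C·γ^s` for all `K ≤ K₀` ([Balaban1985Averaging] Prop. 2 local (52)–(54) on the box below the corner +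
chessboard at the finest level, ✓ `RevelationMartingaleMeanDeviationLogDepth.perPlaquette_tail_allDepths` at depth `j = K`, + `exp_neg_pFun_sq_le_pow`;
the elementary exponent degrades like `L^{−3K}`, so NO `K₀` gives the crux — the kernel certificate that the open content is uniformity in `K`).
[cite: Balaban1985UV3, (7) p.257 and (71) p.273; Balaban1985Averaging, Prop. 2 (52)–(54) p.26] -/
theorem stub_boundedCutoff :
    ∀ (K₀ L : ℕ) (b₀ p₀ : ℝ), 0 < b₀ → 2 < p₀ → ∃ (s C γ₁ : ℝ), 3 < s ∧ 0 ≤ C ∧ 0 < γ₁ ∧ γ₁ ≤ 1 ∧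
        ∀ (F : T3Family) (γ : ℝ), F.L = L → 0 < γ → γ ≤ γ₁ → ∀ (K : ℕ), K ≤ K₀ → ∀ (a : Plaq (F.P K) K),
            (T3UnitScaleTilt.gibbsK F T3UnitLawDensityEML.ℰp γ K).real
                {U | T3UnitScaleTilt.θBal F.L γ b₀ p₀ 0 ≤ GaugeGroup.dist1 (GaugeField.plaqHol
                  (Averaging.iter (fun i => BlockAveraging.blockAvg (P := F.P K) (j := i) T3UnitLawDensityEML.ℰp) K U) a)} ≤
              C * γ ^ s := by
  sorry

/-- STUB 1 — **TOP-SLICE TAIL OF THE BLOCK-AVERAGED FIELD, DEGRADED-GAUSSIAN FORMAT, EVENTUALLY IN THE CUT-OFF** (XL, the organ: Bałaban's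
last-step density representation integrated against the Wilson–Gibbs law, uniformly in `K > K₀` for a `K₀` of the prover's choosing): for
every block size `L` and thresholds `(b₁, p₁)` there are a profile `(b₀, p₀)` beyond them, a cut-off floor `K₀` and constants `c > 0`, `κ ≥ 0`,
`q < 2p₀`, `A`, `C ≥ 0`, `γ₁ ∈ (0, 1]` such that for every family `F` with `F.L = L`, every `0 < γ ≤ γ₁`, EVERY cut-off `K > K₀` and every
top-level plaquette `a`: `Gibbs_K{θ_γ(0) ≤ |Ū^K(∂a) − 1|} ≤ C·γ^(−A)·exp(−c·p(√γ)² + κ·(1 + log(√γ)⁻¹)^q)`.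
[cite: Balaban1985UV3, (39) p.266 and (71) p.273] -/
theorem stub_topTailDegradedEv :
    ∀ (L : ℕ) (b₁ p₁ : ℝ), ∃ (b₀ p₀ : ℝ), b₁ ≤ b₀ ∧ p₁ ≤ p₀ ∧ 0 < b₀ ∧ 2 < p₀ ∧
        ∃ (K₀ : ℕ) (c κ q A C γ₁ : ℝ), 0 < c ∧ 0 ≤ κ ∧ q < 2 * p₀ ∧ 0 ≤ C ∧ 0 < γ₁ ∧ γ₁ ≤ 1 ∧
          ∀ (F : T3Family) (γ : ℝ), F.L = L → 0 < γ → γ ≤ γ₁ → ∀ (K : ℕ), K₀ < K → ∀ (a : Plaq (F.P K) K),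
            (T3UnitScaleTilt.gibbsK F T3UnitLawDensityEML.ℰp γ K).real
                {U | T3UnitScaleTilt.θBal F.L γ b₀ p₀ 0 ≤ GaugeGroup.dist1 (GaugeField.plaqHol
                  (Averaging.iter (fun i => BlockAveraging.blockAvg (P := F.P K) (j := i) T3UnitLawDensityEML.ℰp) K U) a)} ≤
              C * γ ^ (-A) * Real.exp (-(c * B10.pFun b₀ p₀ (Real.sqrt γ) ^ 2) + κ * (1 + Real.log (Real.sqrt γ)⁻¹) ^ q) := by
  sorry

/-- STUB 2 — **ABSORPTION RATE** (M, pure real analysis, no measure; ✓ PROVED by seat ym-line-cst-p1 g23 as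
`Theorems/CoarseStiffnessTailUnitPolyTailLAbsorbRate.lean`, `stub_absorbRate` by name, p690872): for admissible constants the degraded-Gaussian
format is below `C'·γ^s` with some `s > 3` for all small `γ`. [cite: Balaban1985UV3, (7) p.257] -/
theorem stub_absorbRate :
    ∀ (b₀ p₀ c κ q A C : ℝ), 0 < b₀ → 2 < p₀ → 0 < c → 0 ≤ κ → q < 2 * p₀ → 0 ≤ C →
        ∃ (s C' γ₀ : ℝ), 3 < s ∧ 0 ≤ C' ∧ 0 < γ₀ ∧ γ₀ ≤ 1 ∧ ∀ γ : ℝ, 0 < γ → γ ≤ γ₀ →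
          C * γ ^ (-A) * Real.exp (-(c * B10.pFun b₀ p₀ (Real.sqrt γ) ^ 2) + κ * (1 + Real.log (Real.sqrt γ)⁻¹) ^ q) ≤
            C' * γ ^ s := by
  sorry

/-! ## §2 Composition (kernel-checked, no sorry) -/

/-- **THE ROUTE CRUX FROM THE STUBS**: `UnitPolyTailL` (stmt-QuantumFields-24027) BY NAME — profile and cut-off floor `K₀` from stub 1, the
rate (stub 2) above the floor, the bounded-range slice (stub 0) AT that profile up to `K₀`; exponent `min s s₀`, constant `max C' C₀`
(for `0 < γ ≤ 1`, `γ^s ≤ γ^(min s s₀)`), `γ₁ := min (min γ₁ γ₀) γ₂`. -/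
theorem UnitPolyTailL_of
    (h₀ : ∀ (K₀ L : ℕ) (b₀ p₀ : ℝ), 0 < b₀ → 2 < p₀ → ∃ (s C γ₁ : ℝ), 3 < s ∧ 0 ≤ C ∧ 0 < γ₁ ∧ γ₁ ≤ 1 ∧
        ∀ (F : T3Family) (γ : ℝ), F.L = L → 0 < γ → γ ≤ γ₁ → ∀ (K : ℕ), K ≤ K₀ → ∀ (a : Plaq (F.P K) K),
            (T3UnitScaleTilt.gibbsK F T3UnitLawDensityEML.ℰp γ K).real
                {U | T3UnitScaleTilt.θBal F.L γ b₀ p₀ 0 ≤ GaugeGroup.dist1 (GaugeField.plaqHol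
                  (Averaging.iter (fun i => BlockAveraging.blockAvg (P := F.P K) (j := i) T3UnitLawDensityEML.ℰp) K U) a)} ≤
              C * γ ^ s)
    (h₁ : ∀ (L : ℕ) (b₁ p₁ : ℝ), ∃ (b₀ p₀ : ℝ), b₁ ≤ b₀ ∧ p₁ ≤ p₀ ∧ 0 < b₀ ∧ 2 < p₀ ∧
        ∃ (K₀ : ℕ) (c κ q A C γ₁ : ℝ), 0 < c ∧ 0 ≤ κ ∧ q < 2 * p₀ ∧ 0 ≤ C ∧ 0 < γ₁ ∧ γ₁ ≤ 1 ∧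
          ∀ (F : T3Family) (γ : ℝ), F.L = L → 0 < γ → γ ≤ γ₁ → ∀ (K : ℕ), K₀ < K → ∀ (a : Plaq (F.P K) K),
            (T3UnitScaleTilt.gibbsK F T3UnitLawDensityEML.ℰp γ K).real
                {U | T3UnitScaleTilt.θBal F.L γ b₀ p₀ 0 ≤ GaugeGroup.dist1 (GaugeField.plaqHol
                  (Averaging.iter (fun i => BlockAveraging.blockAvg (P := F.P K) (j := i) T3UnitLawDensityEML.ℰp) K U) a)} ≤
              C * γ ^ (-A) * Real.exp (-(c * B10.pFun b₀ p₀ (Real.sqrt γ) ^ 2) + κ * (1 + Real.log (Real.sqrt γ)⁻¹) ^ q))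
    (h₂ : ∀ (b₀ p₀ c κ q A C : ℝ), 0 < b₀ → 2 < p₀ → 0 < c → 0 ≤ κ → q < 2 * p₀ → 0 ≤ C →
        ∃ (s C' γ₀ : ℝ), 3 < s ∧ 0 ≤ C' ∧ 0 < γ₀ ∧ γ₀ ≤ 1 ∧ ∀ γ : ℝ, 0 < γ → γ ≤ γ₀ →
          C * γ ^ (-A) * Real.exp (-(c * B10.pFun b₀ p₀ (Real.sqrt γ) ^ 2) + κ * (1 + Real.log (Real.sqrt γ)⁻¹) ^ q) ≤
            C' * γ ^ s) :
    UnitPolyTailL := by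
  intro L b₁ p₁
  obtain ⟨b₀, p₀, hb₁, hp₁, hb₀, hp₀, K₀, c, κ, q, A, C, γ₁, hc, hκ, hq, hC, hγ₁, hγ₁1, hT⟩ := h₁ L b₁ p₁
  obtain ⟨s, C', γ₀, hs, hC', hγ₀, -, hR⟩ := h₂ b₀ p₀ c κ q A C hb₀ hp₀ hc hκ hq hC
  obtain ⟨s₀, C₀, γ₂, hs₀, hC₀, hγ₂, -, hZ⟩ := h₀ K₀ L b₀ p₀ hb₀ hp₀
  refine ⟨b₀, p₀, hb₁, hp₁, hb₀, hp₀, min s s₀, max C' C₀, min (min γ₁ γ₀) γ₂, lt_min hs hs₀, hC'.trans (le_max_left _ _),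
    lt_min (lt_min hγ₁ hγ₀) hγ₂, ((min_le_left _ _).trans (min_le_left _ _)).trans hγ₁1, fun F γ hFL hγ hγle K a => ?_⟩
  have hγγ₁ : γ ≤ γ₁ := hγle.trans ((min_le_left _ _).trans (min_le_left _ _))
  have hγγ₀ : γ ≤ γ₀ := hγle.trans ((min_le_left _ _).trans (min_le_right _ _))
  have hγγ₂ : γ ≤ γ₂ := hγle.trans (min_le_right _ _)
  have hγ1 : γ ≤ 1 := hγγ₁.trans hγ₁1
  have hmax : (0 : ℝ) ≤ max C' C₀ := hC'.trans (le_max_left _ _)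
  have hpow : ∀ t : ℝ, min s s₀ ≤ t → γ ^ t ≤ γ ^ min s s₀ := fun t ht =>
    Real.rpow_le_rpow_of_exponent_ge hγ hγ1 ht
  rcases Nat.lt_or_ge K₀ K with hK | hK
  swap
  · calc _ ≤ C₀ * γ ^ s₀ := hZ F γ hFL hγ hγγ₂ K hK a
      _ ≤ max C' C₀ * γ ^ min s s₀ :=
        mul_le_mul (le_max_right _ _) (hpow s₀ (min_le_right _ _)) (Real.rpow_nonneg hγ.le _) hmax
  · calc _ ≤ C * γ ^ (-A) * Real.exp (-(c * B10.pFun b₀ p₀ (Real.sqrt γ) ^ 2) + κ * (1 + Real.log (Real.sqrt γ)⁻¹) ^ q) :=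
          hT F γ hFL hγ hγγ₁ K hK a
      _ ≤ C' * γ ^ s := hR γ hγ hγγ₀
      _ ≤ max C' C₀ * γ ^ min s s₀ :=
        mul_le_mul (le_max_left _ _) (hpow s (min_le_left _ _)) (Real.rpow_nonneg hγ.le _) hmax

/-- **THE CRUX FROM THE STUBS**: `UnitScaleTilt.HistoryTailL` (stmt-QuantumFields-19936) BY NAME, through the landed glue
`historyTailL_of_unitPolyTail` (= item `HistoryTailOfUnitPolyTail`, stmt-QuantumFields-24029, CLOSED·proved p690460). -/
theorem HistoryTailL_of : Summit.QuantumFields.YangMills.Theses.UnitScaleTilt.HistoryTailL :=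
  historyTailL_of_unitPolyTail (UnitPolyTailL_of stub_boundedCutoff stub_topTailDegradedEv stub_absorbRate)

/-- the route crux itself from the stubs (record). -/
theorem unitPolyTailL_of_stubs : UnitPolyTailL :=
  UnitPolyTailL_of stub_boundedCutoff stub_topTailDegradedEv stub_absorbRate

end Summit.QuantumFields.YangMills.Cruxes.HistoryTailL.UnitPolyTail
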